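import Literature.Probability.Percolation.SelfRefinementMeasure
import Literature.Probability.Percolation.KohlerSchindlerTassionRSW
import Summits.CriticalPhenomena.CardyFormulaZ2.Theorems.CardySelfRefinementCriticalPathRSWStubCone3Events

/-!
# Stub `stub_cone3` of line `finite-size-envelope` (crux `CriticalPathRSW`), part 9:
from surgery conclusions to pivotality probabilities

Support file for item `stmt-CriticalPhenomena-10267` (stub `stub_cone3`).  Probability layer of the
local surgeries.  With the coin law `P = prodBernoulli (refinementParam 3 ρ c)` (`0 ≤ ρ ≤ 1`,
`0 ≤ c ≤ 1`), the tuple `(b, d)` with its frame `pt⟪α, β⟫`, sub-edges `T`, and the override events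
`Z⟪C, A⟫` ("close `C`, open `A`, the box `[-3n, 3n] × [-9n, 9n]` is crossed"):

* coin biases of the tuple (`ρ` for the selector, `1/2` for the shared and the axial own coins,
  `c` for interior own coins) and the states they force on a cylinder;
* `Cone3.walk_event_subset` — the event "with the tuple closed and the interior labels `O` open
  the sides are not joined, and opening moreover the interior label `g` joins them" lies in
  `Z⟪{g} ∪ T, {g} ∪ O⟫ \ Z⟪{g} ∪ T, ∅ ∪ O⟫`;
* **`Cone3.walk_event_bound`** — `(1/8) c^{|O|} · P(Z⟪{g} ∪ T, {g} ∪ O⟫ \ Z⟪{g} ∪ T, ∅ ∪ O⟫) ≤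
  P(g pivotal)`, `P(g pivotal) = P(Z⟪{g}, {g}⟫ \ Z⟪{g}, ∅⟫)`, uniformly in `ρ`: the tuple is put in
  its all-closed state through BOTH of its representations (selector on & shared coin off, or
  selector off & own coins off, total probability `ρ/2 + (1-ρ)/8 ≥ 1/8`) and the labels of `O`
  are opened at cost `c` each — the `ρ`-uniform constant-state device of the idea card.

References: Aizenman–Grimmett 1991 §3; Grimmett 1999 §2.4 (pivotality), §2.2 (cylinders).
-/

noncomputable section

namespace Summit.CriticalPhenomena.CardyFormulaZ2.Cruxes.CriticalPathRSW.FiniteSizeEnvelope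

open Set MeasureTheory
open Literature.Probability.LatticeModels Literature.Probability.Percolation

namespace Cone3

variable {n : ℕ} {ρ c : ℝ} {b : Site 2} {d d' : Fin 2}

set_option quotPrecheck false

/-- The local frame of the tuple `(b, d)`: `pt⟪α, β⟫ = 3b + α e_d + β e_{d'}`. -/
local notation "pt⟪" α ", " β "⟫" =>
  ((3 : ℤ) • b + (α : ℤ) • (Pi.single d (1 : ℤ) : Site 2) + (β : ℤ) • (Pi.single d' (1 : ℤ) : Site 2))

/-- The open labels of a coin configuration. -/
local notation "Op⟪" S "⟫" => {e : Site 2 × Fin 2 | RefinementOpen 3 S e}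

/-- The override event: close `C`, open `A`, and ask for a left-right crossing of the box. -/
local notation "Z⟪" C ", " A "⟫" =>
  {S : Set (Site 2 × Fin 2 × Fin 3) |
    edgeConfig ((Op⟪S⟫ \ C) ∪ A) ∈ KST2023.crossing (3 * n) (3 * (3 * n))}

/-- The three sub-edges of the tuple. -/
local notation "Tl" =>
  ({(pt⟪0, 0⟫, d), (pt⟪1, 0⟫, d), (pt⟪2, 0⟫, d)} : Set (Site 2 × Fin 2))

/-- The coin law. -/
local notation "P" => (prodBernoulli (refinementParam 3 ρ c))

/-! ### Coin biases -/

/-- The selector has bias `ρ`. -/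
theorem coe_param_selector (hρ0 : 0 ≤ ρ) (hρ1 : ρ ≤ 1) :
    ((refinementParam 3 ρ c (b, d, (2 : Fin 3)) : unitInterval) : ℝ) = ρ := by
  rw [refinementParam_apply_two, Set.projIcc_of_mem _ ⟨hρ0, hρ1⟩]

/-- The shared coin is fair. -/
theorem coe_param_shared : ((refinementParam 3 ρ c (b, d, (1 : Fin 3)) : unitInterval) : ℝ) = 1 / 2 := by
  rw [refinementParam_apply_one, coe_half]

/-- The own coins of the sub-edges are fair. -/
theorem coe_param_sub (hd : d' ≠ d) (j : ℤ) :
    ((refinementParam 3 ρ c (pt⟪j, 0⟫, d, (0 : Fin 3)) : unitInterval) : ℝ) = 1 / 2 := by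
  have h := refinementParam_apply_zero_of_isAxialEdge (k := 3) ρ c (isAxialEdge_sub (b := b) hd j)
  simp only at h
  rw [h, coe_half]

/-- The own coin of an interior label has bias `c`. -/
theorem coe_param_interior (hc0 : 0 ≤ c) (hc1 : c ≤ 1) {ℓ : Site 2 × Fin 2} (hℓ : ¬ IsAxialEdge 3 ℓ) :
    ((refinementParam 3 ρ c (ℓ.1, ℓ.2, (0 : Fin 3)) : unitInterval) : ℝ) = c := by
  rw [refinementParam_apply_zero_of_not_isAxialEdge ρ c hℓ, Set.projIcc_of_mem _ ⟨hc0, hc1⟩]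

/-! ### Small tools -/

/-- `DeterminedBy` is preserved by set difference. -/
theorem determinedBy_sdiff {ι : Type*} {A B : Set (Set ι)} {K : Set ι} (hA : DeterminedBy A K)
    (hB : DeterminedBy B K) : DeterminedBy (A \ B) K := by
  rw [determinedBy_iff] at hA hB ⊢
  intro ω ω' h
  rw [Set.mem_sdiff, Set.mem_sdiff, hA ω ω' h, hB ω ω' h]

/-- The own coin of an interior label is not an own coin of a sub-edge. -/
theorem own_ne_sub (hd : d' ≠ d) {ℓ : Site 2 × Fin 2} (hℓ : ¬ IsAxialEdge 3 ℓ) (j : ℤ) :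
    (pt⟪j, 0⟫, d, (0 : Fin 3)) ≠ (ℓ.1, ℓ.2, (0 : Fin 3)) := by
  intro h
  simp only [Prod.mk.injEq] at h
  apply hℓ
  have : ℓ = (pt⟪j, 0⟫, d) := Prod.ext h.1.symm h.2.1.symm
  rw [this]
  exact isAxialEdge_sub hd j

/-- Interior labels are not sub-edges. -/
theorem not_mem_Tl_of_interior (hd : d' ≠ d) {ℓ : Site 2 × Fin 2} (hℓ : ¬ IsAxialEdge 3 ℓ) : ℓ ∉ Tl := by
  simp only [Set.mem_insert_iff, Set.mem_singleton_iff]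
  rintro (rfl | rfl | rfl) <;> exact hℓ (isAxialEdge_sub hd _)

/-! ### The walk events -/

/-- **The surgery conclusion as an override event.** With the tuple closed and the labels of `O`
opened, "not joined, but joined once `g` is opened too" lies in
`Z⟪{g} ∪ T, {g} ∪ O⟫ \ Z⟪{g} ∪ T, ∅ ∪ O⟫`. -/
theorem walk_event_subset (O : Set (Site 2 × Fin 2)) (g : Site 2 × Fin 2) :
    {S : Set (Site 2 × Fin 2 × Fin 3) |
        edgeConfig ((Op⟪S⟫ \ Tl) ∪ O) ∉ KST2023.crossing (3 * n) (3 * (3 * n)) ∧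
          edgeConfig ((Op⟪S⟫ \ Tl) ∪ O ∪ {g}) ∈ KST2023.crossing (3 * n) (3 * (3 * n))} ⊆
      Z⟪{g} ∪ Tl, {g} ∪ O⟫ \ Z⟪{g} ∪ Tl, ∅ ∪ O⟫ := by
  rintro S ⟨hno, hyes⟩
  have hg : g ∉ (Op⟪S⟫ \ Tl) ∪ O := by
    intro hg
    apply hno
    have heq : (Op⟪S⟫ \ Tl) ∪ O ∪ {g} = (Op⟪S⟫ \ Tl) ∪ O := Set.union_eq_self_of_subset_right (by simpa using hg)
    rwa [heq] at hyes
  constructor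
  · refine crossing_mono (fun e he => ?_) hyes
    rcases he with (⟨heO, heT⟩ | heO) | heg
    · by_cases heg : e = g
      · exact Or.inr (Or.inl heg)
      · exact Or.inl ⟨heO, fun h => h.elim heg heT⟩
    · exact Or.inr (Or.inr heO)
    · exact Or.inr (Or.inl heg)
  · intro h
    apply hno
    refine crossing_mono (fun e he => ?_) h
    rcases he with ⟨heO, heC⟩ | heA
    · exact Or.inl ⟨heO, fun h' => heC (Or.inr h')⟩
    · rcases heA with heA | heA
      · exact absurd heA (Set.notMem_empty e)
      · exact Or.inr heA

/-- **The walk event bound, uniform in `ρ`.** For interior labels `O` (finite) and an interior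
label `g ∉ O`: `(1/8) c^{|O|} · P(Z⟪{g} ∪ T, {g} ∪ O⟫ \ Z⟪{g} ∪ T, ∅ ∪ O⟫) ≤ P(g pivotal)`. -/
theorem walk_event_bound (hd : d' ≠ d) (hρ0 : 0 ≤ ρ) (hρ1 : ρ ≤ 1) (hc0 : 0 ≤ c) (hc1 : c ≤ 1)
    {O : Finset (Site 2 × Fin 2)} (hO : ∀ ℓ ∈ O, ¬ IsAxialEdge 3 ℓ) {g : Site 2 × Fin 2} (hgO : g ∉ O) :
    (1 / 8 : ℝ) * c ^ O.card *
        (P).real (Z⟪{g} ∪ Tl, {g} ∪ ↑O⟫ \ Z⟪{g} ∪ Tl, ∅ ∪ ↑O⟫) ≤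
      (P).real (Z⟪({g} : Set (Site 2 × Fin 2)), ({g} : Set (Site 2 × Fin 2))⟫ \
        Z⟪({g} : Set (Site 2 × Fin 2)), (∅ : Set (Site 2 × Fin 2))⟫) := by
  classical
  -- names
  set E := Z⟪{g} ∪ Tl, {g} ∪ ↑O⟫ \ Z⟪{g} ∪ Tl, ∅ ∪ ↑O⟫ with hE
  set Piv := Z⟪({g} : Set (Site 2 × Fin 2)), ({g} : Set (Site 2 × Fin 2))⟫ \
    Z⟪({g} : Set (Site 2 × Fin 2)), (∅ : Set (Site 2 × Fin 2))⟫ with hPiv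
  set σ : Site 2 × Fin 2 × Fin 3 := (b, d, (2 : Fin 3)) with hσ
  set h : Site 2 × Fin 2 × Fin 3 := (b, d, (1 : Fin 3)) with hh
  set o₀ : Site 2 × Fin 2 × Fin 3 := (pt⟪0, 0⟫, d, (0 : Fin 3)) with ho₀
  set o₁ : Site 2 × Fin 2 × Fin 3 := (pt⟪1, 0⟫, d, (0 : Fin 3)) with ho₁
  set o₂ : Site 2 × Fin 2 × Fin 3 := (pt⟪2, 0⟫, d, (0 : Fin 3)) with ho₂
  set Oc : Finset (Site 2 × Fin 2 × Fin 3) := O.image (fun ℓ => (ℓ.1, ℓ.2, (0 : Fin 3))) with hOc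
  set F₁ : Finset (Site 2 × Fin 2 × Fin 3) := insert σ (insert h Oc) with hF₁
  set F₂ : Finset (Site 2 × Fin 2 × Fin 3) := insert σ (insert o₀ (insert o₁ (insert o₂ Oc))) with hF₂
  set Y₁ := localCylinder (↑F₁ : Set (Site 2 × Fin 2 × Fin 3)) (insert σ (↑Oc : Set (Site 2 × Fin 2 × Fin 3)))
    with hY₁
  set Y₂ := localCylinder (↑F₂ : Set (Site 2 × Fin 2 × Fin 3)) (↑Oc : Set (Site 2 × Fin 2 × Fin 3)) with hY₂
  -- distinctness of coins
  have hσh : σ ≠ h := by simp [hσ, hh]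
  have hσOc : σ ∉ Oc := by
    simp only [hOc, Finset.mem_image, not_exists, not_and, hσ]
    intro ℓ _ h'; simp [Prod.mk.injEq] at h'
  have hhOc : h ∉ Oc := by
    simp only [hOc, Finset.mem_image, not_exists, not_and, hh]
    intro ℓ _ h'; simp [Prod.mk.injEq] at h'
  have hoOc : ∀ j : ℤ, (pt⟪j, 0⟫, d, (0 : Fin 3)) ∉ Oc := by
    intro j hj
    simp only [hOc, Finset.mem_image] at hj
    obtain ⟨ℓ, hℓ, hℓj⟩ := hj
    exact own_ne_sub hd (hO ℓ hℓ) j hℓj.symm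
  have hσo : ∀ j : ℤ, σ ≠ (pt⟪j, 0⟫, d, (0 : Fin 3)) := by intro j; simp [hσ]
  have ho01 : o₀ ≠ o₁ := by
    simp only [ho₀, ho₁, Ne, Prod.mk.injEq, pt_eq_iff hd]; norm_num
  have ho02 : o₀ ≠ o₂ := by
    simp only [ho₀, ho₂, Ne, Prod.mk.injEq, pt_eq_iff hd]; norm_num
  have ho12 : o₁ ≠ o₂ := by
    simp only [ho₁, ho₂, Ne, Prod.mk.injEq, pt_eq_iff hd]; norm_num
  have hσF₁ : σ ∉ insert h Oc := by simp [hσh, hσOc]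
  have ho₂F : o₂ ∉ Oc := hoOc 2
  have ho₁F : o₁ ∉ insert o₂ Oc := by
    rw [Finset.mem_insert, not_or]; exact ⟨ho12, hoOc 1⟩
  have ho₀F : o₀ ∉ insert o₁ (insert o₂ Oc) := by
    simp only [Finset.mem_insert, not_or]; exact ⟨ho01, ho02, hoOc 0⟩
  have hσF₂ : σ ∉ insert o₀ (insert o₁ (insert o₂ Oc)) := by
    simp only [Finset.mem_insert, not_or]; exact ⟨hσo 0, hσo 1, hσo 2, hσOc⟩
  -- states forced on the cylinders
  have hY₁σ : ∀ S ∈ Y₁, σ ∈ S := fun S hS =>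
    (hS σ (by simp [hF₁])).2 (Set.mem_insert _ _)
  have hY₁h : ∀ S ∈ Y₁, h ∉ S := fun S hS hS' => by
    have := (hS h (by simp [hF₁])).1 hS'
    simp only [Set.mem_insert_iff, Finset.mem_coe] at this
    exact this.elim (fun h' => hσh h'.symm) hhOc
  have hY₂σ : ∀ S ∈ Y₂, σ ∉ S := fun S hS hS' => hσOc ((hS σ (by simp [hF₂])).1 hS')
  have hY₂o : ∀ S ∈ Y₂, ∀ j : ℤ, (j = 0 ∨ j = 1 ∨ j = 2) → (pt⟪j, 0⟫, d, (0 : Fin 3)) ∉ S := by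
    intro S hS j hj hS'
    have hjF : (pt⟪j, 0⟫, d, (0 : Fin 3)) ∈ F₂ := by
      rcases hj with rfl | rfl | rfl <;> simp [hF₂, ho₀, ho₁, ho₂]
    exact hoOc j ((hS _ (Finset.mem_coe.2 hjF)).1 hS')
  have hYO : ∀ S, (S ∈ Y₁ ∨ S ∈ Y₂) → ∀ ℓ ∈ (↑O : Set (Site 2 × Fin 2)), RefinementOpen 3 S ℓ := by
    intro S hS ℓ hℓ
    rw [Finset.mem_coe] at hℓ
    rw [refinementOpen_iff_of_not_axial (hO ℓ hℓ)]
    have hc : (ℓ.1, ℓ.2, (0 : Fin 3)) ∈ Oc := Finset.mem_image_of_mem _ hℓ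
    rcases hS with hS | hS
    · exact (hS _ (by simp [hF₁, hc])).2 (Set.mem_insert_of_mem _ (Finset.mem_coe.2 hc))
    · exact (hS _ (by simp [hF₂, hc])).2 (Finset.mem_coe.2 hc)
  have hYT : ∀ S, (S ∈ Y₁ ∨ S ∈ Y₂) → ∀ e ∈ Tl, ¬ RefinementOpen 3 S e := by
    intro S hS e he
    have key : ∀ j : ℤ, 0 ≤ j → j < 3 → ¬ RefinementOpen 3 S (pt⟪j, 0⟫, d) := by
      intro j h0 h3
      rw [refinementOpen_sub_iff hd S h0 h3]
      rcases hS with hS | hS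
      · rintro (⟨-, h'⟩ | ⟨h', -⟩)
        · exact hY₁h S hS h'
        · exact h' (hY₁σ S hS)
      · rintro (⟨h', -⟩ | ⟨-, h'⟩)
        · exact hY₂σ S hS h'
        · exact hY₂o S hS j (by omega) h'
    simp only [Set.mem_insert_iff, Set.mem_singleton_iff] at he
    rcases he with rfl | rfl | rfl
    · exact key 0 le_rfl (by norm_num)
    · exact key 1 (by norm_num) (by norm_num)
    · exact key 2 (by norm_num) (by norm_num)
  -- on the cylinders the pivotality event is `E`
  have hOC : ∀ e ∈ (↑O : Set (Site 2 × Fin 2)), e ∉ ({g} ∪ Tl : Set (Site 2 × Fin 2)) := by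
    intro e he he'
    rw [Finset.mem_coe] at he
    rcases he' with he' | he'
    · rw [Set.mem_singleton_iff] at he'; exact hgO (he' ▸ he)
    · exact not_mem_Tl_of_interior hd (hO e he) he'
  have hPivY : ∀ Y : Set (Set (Site 2 × Fin 2 × Fin 3)), (Y = Y₁ ∨ Y = Y₂) → Piv ∩ Y = E ∩ Y := by
    intro Y hY
    have hT' : ∀ S ∈ Y, ∀ e ∈ Tl, ¬ RefinementOpen 3 S e := fun S hS =>
      hYT S (hY.elim (fun h' => Or.inl (h' ▸ hS)) (fun h' => Or.inr (h' ▸ hS)))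
    have hO' : ∀ S ∈ Y, ∀ ℓ ∈ (↑O : Set (Site 2 × Fin 2)), RefinementOpen 3 S ℓ := fun S hS =>
      hYO S (hY.elim (fun h' => Or.inl (h' ▸ hS)) (fun h' => Or.inr (h' ▸ hS)))
    have h1 : Z⟪({g} : Set (Site 2 × Fin 2)), ({g} : Set (Site 2 × Fin 2))⟫ ∩ Y = Z⟪{g} ∪ Tl, {g} ∪ ↑O⟫ ∩ Y := by
      rw [Z_inter_eq_of_closed hT', Z_inter_eq_of_open hO' hOC]
    have h2 : Z⟪({g} : Set (Site 2 × Fin 2)), (∅ : Set (Site 2 × Fin 2))⟫ ∩ Y = Z⟪{g} ∪ Tl, ∅ ∪ ↑O⟫ ∩ Y := by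
      rw [Z_inter_eq_of_closed hT', Z_inter_eq_of_open hO' hOC]
    rw [hPiv, hE]
    ext S
    constructor
    · rintro ⟨⟨hS1, hS2⟩, hSY⟩
      exact ⟨⟨((Set.ext_iff.1 h1 S).1 ⟨hS1, hSY⟩).1,
        fun hS2' => hS2 ((Set.ext_iff.1 h2 S).2 ⟨hS2', hSY⟩).1⟩, hSY⟩
    · rintro ⟨⟨hS1, hS2⟩, hSY⟩
      exact ⟨⟨((Set.ext_iff.1 h1 S).2 ⟨hS1, hSY⟩).1,
        fun hS2' => hS2 ((Set.ext_iff.1 h2 S).1 ⟨hS2', hSY⟩).1⟩, hSY⟩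
  -- measurability and locality of `E`
  have hEm : MeasurableSet E := (measurableSet_Z _ _).diff (measurableSet_Z _ _)
  have hPivm : MeasurableSet Piv := (measurableSet_Z _ _).diff (measurableSet_Z _ _)
  have hsubT : ∀ F : Finset (Site 2 × Fin 2 × Fin 3), (∀ i ∈ F, i = σ ∨ i = h ∨ i = o₀ ∨ i = o₁ ∨ i = o₂ ∨ i ∈ Oc) →
      (↑F : Set (Site 2 × Fin 2 × Fin 3)) ⊆ {(b, d, (2 : Fin 3)), (b, d, (1 : Fin 3)), (pt⟪0, 0⟫, d, (0 : Fin 3)),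
        (pt⟪1, 0⟫, d, (0 : Fin 3)), (pt⟪2, 0⟫, d, (0 : Fin 3))} ∪
        (fun ℓ : Site 2 × Fin 2 => (ℓ.1, ℓ.2, (0 : Fin 3))) '' (↑O ∪ {g}) := by
    intro F hF i hi
    rcases hF i (Finset.mem_coe.1 hi) with rfl | rfl | rfl | rfl | rfl | hi'
    · exact Or.inl (by simp [hσ])
    · exact Or.inl (by simp [hh])
    · exact Or.inl (by simp [ho₀])
    · exact Or.inl (by simp [ho₁])
    · exact Or.inl (by simp [ho₂])
    · simp only [hOc, Finset.mem_image] at hi'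
      obtain ⟨ℓ, hℓ, rfl⟩ := hi'
      exact Or.inr ⟨ℓ, Or.inl (Finset.mem_coe.2 hℓ), rfl⟩
  have hCA : ∀ A : Set (Site 2 × Fin 2), (↑O : Set (Site 2 × Fin 2)) ⊆ A → ∀ e : Site 2 × Fin 2,
      (e = (pt⟪0, 0⟫, d) ∨ e = (pt⟪1, 0⟫, d) ∨ e = (pt⟪2, 0⟫, d) ∨ e ∈ (↑O ∪ {g} : Set (Site 2 × Fin 2))) →
      e ∈ ({g} ∪ Tl : Set (Site 2 × Fin 2)) ∪ A := by
    intro A hA e he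
    rcases he with rfl | rfl | rfl | he | he
    · exact Or.inl (Or.inr (by simp))
    · exact Or.inl (Or.inr (by simp))
    · exact Or.inl (Or.inr (by simp))
    · exact Or.inr (hA he)
    · exact Or.inl (Or.inl he)
  have hdet : ∀ F : Finset (Site 2 × Fin 2 × Fin 3), (∀ i ∈ F, i = σ ∨ i = h ∨ i = o₀ ∨ i = o₁ ∨ i = o₂ ∨ i ∈ Oc) →
      DeterminedBy E (↑F : Set (Site 2 × Fin 2 × Fin 3))ᶜ := by
    intro F hF
    exact determinedBy_sdiff (determinedBy_Z hd (hsubT F hF) (hCA _ Set.subset_union_right))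
      (determinedBy_Z hd (hsubT F hF) (hCA _ Set.subset_union_right))
  have hF₁mem : ∀ i ∈ F₁, i = σ ∨ i = h ∨ i = o₀ ∨ i = o₁ ∨ i = o₂ ∨ i ∈ Oc := by
    intro i hi
    simp only [hF₁, Finset.mem_insert] at hi
    rcases hi with hi | hi | hi
    · exact Or.inl hi
    · exact Or.inr (Or.inl hi)
    · exact Or.inr (Or.inr (Or.inr (Or.inr (Or.inr hi))))
  have hF₂mem : ∀ i ∈ F₂, i = σ ∨ i = h ∨ i = o₀ ∨ i = o₁ ∨ i = o₂ ∨ i ∈ Oc := by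
    intro i hi
    simp only [hF₂, Finset.mem_insert] at hi
    rcases hi with hi | hi | hi | hi | hi
    · exact Or.inl hi
    · exact Or.inr (Or.inr (Or.inl hi))
    · exact Or.inr (Or.inr (Or.inr (Or.inl hi)))
    · exact Or.inr (Or.inr (Or.inr (Or.inr (Or.inl hi))))
    · exact Or.inr (Or.inr (Or.inr (Or.inr (Or.inr hi))))
  -- probabilities of the cylinders
  have hOcard : Oc.card ≤ O.card := Finset.card_image_le
  have hprodOc : ∀ pat : Set (Site 2 × Fin 2 × Fin 3), (↑Oc : Set (Site 2 × Fin 2 × Fin 3)) ⊆ pat →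
      c ^ O.card ≤ ∏ i ∈ Oc, (if i ∈ pat then ((refinementParam 3 ρ c i : unitInterval) : ℝ)
        else 1 - ((refinementParam 3 ρ c i : unitInterval) : ℝ)) := by
    intro pat hpat
    have : ∏ i ∈ Oc, (if i ∈ pat then ((refinementParam 3 ρ c i : unitInterval) : ℝ)
        else 1 - ((refinementParam 3 ρ c i : unitInterval) : ℝ)) = ∏ i ∈ Oc, c := by
      refine Finset.prod_congr rfl fun i hi => ?_
      rw [if_pos (hpat (Finset.mem_coe.2 hi))]
      simp only [hOc, Finset.mem_image] at hi
      obtain ⟨ℓ, hℓ, rfl⟩ := hi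
      exact coe_param_interior hc0 hc1 (hO ℓ hℓ)
    rw [this, Finset.prod_const]
    exact pow_le_pow_of_le_one hc0 hc1 hOcard
  have hY₁prob : ρ * (1 / 2) * c ^ O.card ≤ (P).real Y₁ := by
    rw [hY₁, real_localCylinder_eq, hF₁, Finset.prod_insert hσF₁, Finset.prod_insert hhOc,
      if_pos (Set.mem_insert _ _), if_neg, coe_param_selector hρ0 hρ1, coe_param_shared]
    · have := hprodOc (insert σ ↑Oc) (Set.subset_insert _ _)
      have h12 : (0 : ℝ) ≤ ρ * (1 / 2) := by positivity
      refine le_trans (mul_le_mul_of_nonneg_left this h12) (le_of_eq ?_)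
      ring
    · simp only [Set.mem_insert_iff, Finset.mem_coe, not_or]
      exact ⟨fun h' => hσh h'.symm, hhOc⟩
  have hY₂prob : (1 - ρ) * (1 / 8) * c ^ O.card ≤ (P).real Y₂ := by
    rw [hY₂, real_localCylinder_eq, hF₂, Finset.prod_insert hσF₂, Finset.prod_insert ho₀F,
      Finset.prod_insert ho₁F, Finset.prod_insert ho₂F, if_neg (fun h' => hσOc (Finset.mem_coe.1 h')),
      if_neg (fun h' => hoOc 0 (Finset.mem_coe.1 h')), if_neg (fun h' => hoOc 1 (Finset.mem_coe.1 h')),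
      if_neg (fun h' => hoOc 2 (Finset.mem_coe.1 h')), coe_param_selector hρ0 hρ1, ho₀, ho₁, ho₂,
      coe_param_sub hd, coe_param_sub hd, coe_param_sub hd]
    have := hprodOc ↑Oc Set.Subset.rfl
    have h12 : (0 : ℝ) ≤ (1 - ρ) * (1 / 8) := by nlinarith
    refine le_trans (mul_le_mul_of_nonneg_left this h12) (le_of_eq ?_)
    ring
  -- the two cylinders are disjoint and factor out
  have hdisj : Disjoint (Piv ∩ Y₁) (Piv ∩ Y₂) :=
    Set.disjoint_left.2 fun S h1 h2 => hY₂σ S h2.2 (hY₁σ S h1.2)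
  have hY₁m : MeasurableSet Y₁ := measurableSet_localCylinder F₁.finite_toSet.countable _
  have hY₂m : MeasurableSet Y₂ := measurableSet_localCylinder F₂.finite_toSet.countable _
  have hfac₁ : (P).real (Piv ∩ Y₁) = (P).real Y₁ * (P).real E := by
    rw [hPivY Y₁ (Or.inl rfl), Set.inter_comm]; exact real_localCylinder_inter _ F₁ _ (hdet F₁ hF₁mem) hEm
  have hfac₂ : (P).real (Piv ∩ Y₂) = (P).real Y₂ * (P).real E := by
    rw [hPivY Y₂ (Or.inr rfl), Set.inter_comm]; exact real_localCylinder_inter _ F₂ _ (hdet F₂ hF₂mem) hEm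
  have hsum : (P).real (Piv ∩ Y₁) + (P).real (Piv ∩ Y₂) ≤ (P).real Piv := by
    rw [← measureReal_union hdisj (hPivm.inter hY₂m)]
    exact measureReal_mono (Set.union_subset Set.inter_subset_left Set.inter_subset_left)
  have hE0 : 0 ≤ (P).real E := measureReal_nonneg
  have hcO : 0 ≤ c ^ O.card := pow_nonneg hc0 _
  calc (1 / 8 : ℝ) * c ^ O.card * (P).real E
      ≤ (ρ * (1 / 2) * c ^ O.card + (1 - ρ) * (1 / 8) * c ^ O.card) * (P).real E := by
        apply mul_le_mul_of_nonneg_right _ hE0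
        nlinarith
    _ ≤ ((P).real Y₁ + (P).real Y₂) * (P).real E := by
        apply mul_le_mul_of_nonneg_right _ hE0
        linarith
    _ = (P).real (Piv ∩ Y₁) + (P).real (Piv ∩ Y₂) := by rw [hfac₁, hfac₂]; ring
    _ ≤ (P).real Piv := hsum

end Cone3

/-- **Registered sub-goal `stub_cone3_pivot` of stub `stub_cone3`** (`Cone3.walk_event_bound` with all local notations
expanded). -/
theorem stub_cone3_pivot : ∀ {n : ℕ} {ρ c : ℝ} {b : Site 2} {d d' : Fin 2} (hd : d' ≠ d) (hρ0 : 0 ≤ ρ) (hρ1 : ρ ≤ 1) (hc0 : 0 ≤ c) (hc1 : c ≤ 1) {O : Finset (Site 2 × Fin 2)} (hO : ∀ ℓ ∈ O, ¬ IsAxialEdge 3 ℓ) {g : Site 2 × Fin 2} (hgO : g ∉ O), (1 / 8 : ℝ) * c ^ O.card * (((prodBernoulli (refinementParam 3 ρ c)))).real (({S : Set (Site 2 × Fin 2 × Fin 3) | edgeConfig ((({e : Site 2 × Fin 2 | RefinementOpen 3 (S) e}) \ ({g} ∪ (({((((3 : ℤ) • b + ((0) : ℤ) • (Pi.single d (1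 : ℤ) : Site 2) + ((0) : ℤ) • (Pi.single d' (1 : ℤ) : Site 2))), d), ((((3 : ℤ) • b + ((1) : ℤ) • (Pi.single d (1 : ℤ) : Site 2) + ((0) : ℤ) • (Pi.single d' (1 : ℤ) : Site 2))), d), ((((3 : ℤ) • b + ((2) : ℤ) • (Pi.single d (1 : ℤ) : Site 2) + ((0) : ℤ) • (Pi.single d' (1 : ℤ) : Site 2))), d)} : Set (Site 2 × Fin 2))))) ∪ ({g} ∪ ↑O)) ∈ KST2023.crossing (3 * n) (3 * (3 * n))}) \ ({S : Set (Site 2 × Fin 2 × Fin 3) | edgeConfig ((({e : Site 2 × Fin 2 | RefinementOpen 3 (S) e}) \ ({g} ∪ (({((((3 : ℤ) • b + ((0) : ℤ) • (Pi.single d (1 : ℤ) : Site 2) + ((0) : ℤ) • (Pi.single d' (1 : ℤ) : Site 2))), d), ((((3 : ℤ) • b + ((1) : ℤ) • (Pi.single d (1 : ℤ) : Site 2) + ((0) : ℤ) • (Pi.single d' (1 : ℤ) : Site 2))), d), ((((3 : ℤ) • b + ((2) : ℤ) • (Pi.single d (1 : ℤ) : Site 2) + ((0) : ℤ) • (Pi.single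 d' (1 : ℤ) : Site 2))), d)} : Set (Site 2 × Fin 2))))) ∪ (∅ ∪ ↑O)) ∈ KST2023.crossing (3 * n) (3 * (3 * n))})) ≤ (((prodBernoulli (refinementParam 3 ρ c)))).real (({S : Set (Site 2 × Fin 2 × Fin 3) | edgeConfig ((({e : Site 2 × Fin 2 | RefinementOpen 3 (S) e}) \ (({g} : Set (Site 2 × Fin 2)))) ∪ (({g} : Set (Site 2 × Fin 2)))) ∈ KST2023.crossing (3 * n) (3 * (3 * n))}) \ ({S : Set (Site 2 × Fin 2 × Fin 3) | edgeConfig ((({e : Site 2 × Fin 2 | RefinementOpen 3 (S) e}) \ (({g} : Set (Site 2 × Fin 2)))) ∪ ((∅ : Set (Site 2 × Fin 2)))) ∈ KST2023.crossing (3 * n) (3 * (3 * n))})) := by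
  intro n ρ c b d d' hd hρ0 hρ1 hc0 hc1 O hO g hgO
  exact Cone3.walk_event_bound hd hρ0 hρ1 hc0 hc1 hO hgO

end Summit.CriticalPhenomena.CardyFormulaZ2.Cruxes.CriticalPathRSW.FiniteSizeEnvelope

end
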